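import Mathlib
import HarnessLib
import Summits.QuantumAdvantage.QuantumAdvantage.Theorems.PumpDialA
import Summits.QuantumAdvantage.AdviceFreeQNC0.ConstantBellsDense
import Summits.QuantumAdvantage.QuantumAdvantage.Theorems.RigidityLawsA
import Summits.QuantumAdvantage.AdviceFreeQNC0.TransferWalk

/-!
# PumpDial, part B (sections Board, Restrict) — support for item stmt-QuantumAdvantage-28487

Cell decomp-qadv, seat lens-4 («minimal counterexample / extremal reduction»), generation 25 — land port of the node
«PumpDial» (published under the cell's HOME/decomp-qadv-lens-4/g25/PumpDial.lean rev 3, sha256 59c460875773e61d…, record NODE-g25.md;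
RESIDUAL MODE on AbsorptionDial:28487 `NoPerfectPolyOdd`).  The node file with ONLY the namespace renamed
`Theses.PumpDial → Theorems.PumpDial`, `example`s dropped and one-line docstrings added where missing, cut into chain-imported parts;
the X-side junction theorems (conclusion `AbsorptionDial.NoPerfectPolyOdd` BY NAME) live in the LAST part, the only one importing
`Theses.AbsorptionDial`; every other part imports only `AdviceFreeQNC0.*`, `Literature.Computability.MetaComplexity.*`, HarnessLib, Mathlib
(no import path to any Theses file — checked on the tree's import lines), so route items can be typed BY NAME over these parts.
No `sorry`, no new axioms, no instances, no notation.

This part: `glueS` … `diag_of_offdiag_sameLen` (36 declarations).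
-/

set_option autoImplicit false
set_option linter.dupNamespace false

noncomputable section

namespace Summit.QuantumAdvantage.QuantumAdvantage.Theorems.PumpDial
open Classical
open Finset
open Summit.QuantumAdvantage.AdviceFreeQNC0
open Summit.QuantumAdvantage.AdviceFreeQNC0.TwoShot
open Summit.QuantumAdvantage.AdviceFreeQNC0.CharK
open Literature.Computability.MetaComplexity Literature.Computability.MetaComplexity.Smolensky

section Board

variable {n : ℕ}

/-- FIRST-BIT GLUING: cut `0` silent; on inputs with first bit `b` play `y_b` on the remaining `n` bits
(cut `h + 1` of the long board ↦ cut `h` of the short one). -/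
def glueS (y0 y1 : Strat n) : Strat (n + 1) := fun g u =>
  if h : g = 0 then false else (if u 0 = true then y1 else y0) (g.pred h) (Fin.tail u)

/-- `glueS_zero` (PumpDial g25, section Board). -/
theorem glueS_zero (y0 y1 : Strat n) (u : Fin (n + 1) → Bool) : glueS y0 y1 0 u = false := by
  simp [glueS]

/-- `glueS_succ` (PumpDial g25, section Board). -/
theorem glueS_succ (y0 y1 : Strat n) (h : Fin (n + 1)) (b : Bool) (v : Fin n → Bool) :
    glueS y0 y1 h.succ (Fin.cons b v) = (if b = true then y1 else y0) h v := by
  unfold glueS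
  rw [dif_neg (Fin.succ_ne_zero h)]
  simp only [Fin.cons_zero, Fin.pred_succ, Fin.tail_cons]

/-- the glued game (tree `chargeRecursion`): `WIN_c(glue y0 y1)(b :: u') = WIN_{c+1+2b}(y_b)(u')`. -/
theorem ringWinU_glueS (c : ℕ) (y0 y1 : Strat n) (b : Bool) (u' : Fin n → Bool) :
    ringWinU c (glueS y0 y1) (Fin.cons b u') = ringWinU (c + 1 + 2 * b.toNat) (if b = true then y1 else y0) u' := by
  have hfun : (fun h v => glueS y0 y1 h.succ (Fin.cons b v)) = (if b = true then y1 else y0) := by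
    funext h v; exact glueS_succ y0 y1 h b v
  have key := chargeRecursion n c (glueS y0 y1) b u'
  rw [glueS_zero, Bool.false_and, Bool.false_xor, hfun] at key
  exact key

/-- **GLUING LAW**: perfect strategies at charges `c + 1` (first bit `0`) and `c` (first bit `1`) on `n` bits glue to a
perfect strategy at charge `c` on `n + 1` bits. -/
theorem perfect_glueS {c : ℕ} {y0 y1 : Strat n} (h0 : Perfect (c + 1) y0) (h1 : Perfect c y1) :
    Perfect c (glueS y0 y1) := by
  intro u
  rw [← Fin.cons_self_tail u, ringWinU_glueS]
  cases u 0
  · exact h0 _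
  · rw [show (if true = true then y1 else y0) = y1 from rfl, show c + 1 + 2 * Bool.toNat true = c + 3 from rfl,
      ringWinU_charge_mod (show (c + 3) % 3 = c % 3 by omega)]
    exact h1 _

/-- `hasDegF_glueS_zero` (PumpDial g25, section Board). -/
theorem hasDegF_glueS_zero {p : ℕ} [Fact p.Prime] (y0 y1 : Strat n) (d : ℕ) : HasDegF p (glueS y0 y1 0) d := by
  unfold HasDegF
  have : (fun x => if glueS y0 y1 0 x = true then (1 : ZMod p) else 0) = 0 := by
    funext x; simp [glueS]
  rw [this]; exact Submodule.zero_mem _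

/-- `hasDegF_tail_comp` (PumpDial g25, section Board). -/
theorem hasDegF_tail_comp {p : ℕ} [Fact p.Prime] {d : ℕ} {f : (Fin n → Bool) → Bool} (hf : HasDegF p f d) :
    HasDegF p (fun u : Fin (n + 1) → Bool => f (Fin.tail u)) d := by
  unfold HasDegF at hf ⊢
  refine AdviceFreeQNC0.comp_mem_lowDeg_of_coord (F := ZMod p) (fun u : Fin (n + 1) → Bool => Fin.tail u)
    (fun i => ?_) hf
  have e : (fun u : Fin (n + 1) → Bool => if Fin.tail u i = true then (1 : ZMod p) else 0) =
      mono (ZMod p) {i.succ} := by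
    funext u; simp only [mono_apply, Finset.mem_singleton, forall_eq]; rfl
  rw [e]; exact mono_mem_lowDeg (by simp)

/-- degree of a glued cut: `𝟙[glue] = x₀·(Y₁∘tail) + (1 − x₀)·(Y₀∘tail)`, degree `d + 1`. -/
theorem hasDegF_glueS_succ {p : ℕ} [Fact p.Prime] {d : ℕ} {y0 y1 : Strat n} (h : Fin (n + 1))
    (h0 : HasDegF p (y0 h) d) (h1 : HasDegF p (y1 h) d) : HasDegF p (glueS y0 y1 h.succ) (d + 1) := by
  have key : (fun x : Fin (n + 1) → Bool => if glueS y0 y1 h.succ x = true then (1 : ZMod p) else 0) =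
      mono (ZMod p) {0} * (fun x => if y1 h (Fin.tail x) = true then (1 : ZMod p) else 0) +
      (1 - mono (ZMod p) {0}) * (fun x => if y0 h (Fin.tail x) = true then (1 : ZMod p) else 0) := by
    funext x
    have hx : glueS y0 y1 h.succ x = (if x 0 = true then y1 else y0) h (Fin.tail x) := by
      conv_lhs => rw [← Fin.cons_self_tail x]
      rw [glueS_succ]
    rw [hx]
    simp only [Pi.add_apply, Pi.mul_apply, Pi.sub_apply, Pi.one_apply, mono_apply, Finset.mem_singleton, forall_eq]
    rcases Bool.eq_false_or_eq_true (x 0) with hb | hb <;> simp [hb]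
  unfold HasDegF
  rw [key]
  have hm : mono (ZMod p) ({0} : Finset (Fin (n + 1))) ∈ lowDeg (ZMod p) (n + 1) 1 := mono_mem_lowDeg (by simp)
  have h1m : (1 - mono (ZMod p) ({0} : Finset (Fin (n + 1)))) ∈ lowDeg (ZMod p) (n + 1) 1 :=
    Submodule.sub_mem _ (by rw [← mono_empty]; exact mono_mem_lowDeg (by simp)) hm
  have := Submodule.add_mem _ (mul_mem_lowDeg_add hm (hasDegF_tail_comp h1))
    (mul_mem_lowDeg_add h1m (hasDegF_tail_comp h0))
  rw [add_comm 1 d] at this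
  exact this

/-- `hasDegF_glueS` (PumpDial g25, section Board). -/
theorem hasDegF_glueS {p : ℕ} [Fact p.Prime] {d : ℕ} {y0 y1 : Strat n} (h0 : ∀ h, HasDegF p (y0 h) d)
    (h1 : ∀ h, HasDegF p (y1 h) d) (g : Fin (n + 2)) : HasDegF p (glueS y0 y1 g) (d + 1) := by
  refine Fin.cases ?_ (fun h => ?_) g
  · exact hasDegF_glueS_zero y0 y1 (d + 1)
  · exact hasDegF_glueS_succ h (h0 h) (h1 h)

/-- gluing at the level of boards: `PerfAt (n, c+1, d) ∧ PerfAt (n, c, d) ⟹ PerfAt (n+1, c, d+1)`. -/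
theorem perfAt_glue {p : ℕ} [Fact p.Prime] {c d : ℕ} (h0 : PerfAt p n (c + 1) d) (h1 : PerfAt p n c d) :
    PerfAt p (n + 1) c (d + 1) := by
  obtain ⟨y0, hy0, hd0⟩ := h0
  obtain ⟨y1, hy1, hd1⟩ := h1
  exact ⟨glueS y0 y1, perfect_glueS hy0 hy1, hasDegF_glueS hd0 hd1⟩

/-- **LAW (PROVED): every perfect board reaches the DIAGONAL at the cost of one degree.**  If `(n, c)` carries a
perfect strategy of degree `d`, then a DIAGONAL board (`c' ≡ n' (mod 3)`) of length `n' ∈ {n, n+1}` carries one of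
degree `d + 1`: off the diagonal, the board and its charge-dual (complement) are the two charges `{e, e+1}` that glue
into the diagonal board one bit longer. Hence `X ⟺ X restricted to diagonal boards` (`target_iff_diag`). -/
theorem diag_of_perfAt {p : ℕ} [Fact p.Prime] {c d : ℕ} (hP : PerfAt p n c d) :
    ∃ n' c', (n' = n ∨ n' = n + 1) ∧ c' % 3 = n' % 3 ∧ PerfAt p n' c' (d + 1) := by
  have h3 : c % 3 = n % 3 ∨ c % 3 = (n + 1) % 3 ∨ c % 3 = (n + 2) % 3 := by omega
  rcases h3 with h | h | h
  · exact ⟨n, c, Or.inl rfl, h, perfAt_mono (Nat.le_succ d) hP⟩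
  · -- `c ≡ n+1`: the dual charge is `≡ c+1`; glue (dual at `c+1`, original at `c`) into `(n+1, c)`, diagonal.
    have hP' : PerfAt p n (c + 1) d := perfAt_complS (by omega) hP
    exact ⟨n + 1, c, Or.inr rfl, by omega, perfAt_glue hP' hP⟩
  · -- `c ≡ n+2`: the dual charge is `e :≡ n+1 ≡ c+2`, and `c ≡ e+1`; glue into `(n+1, e)`, diagonal.
    have hPe : PerfAt p n (c + 2) d := perfAt_complS (by omega) hP
    have hP0 : PerfAt p n (c + 2 + 1) d := perfAt_charge_mod (by omega) hP
    exact ⟨n + 1, c + 2, Or.inr rfl, by omega, perfAt_glue hP0 hPe⟩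

/-- polylog bookkeeping: `(log₂ n)^C + 1 ≤ (log₂ n₁)^(C+1)` for `4 ≤ n ≤ n₁`. -/
theorem pow_log_succ_le {n n₁ C : ℕ} (hn : 4 ≤ n) (h₁ : n ≤ n₁) :
    (Nat.log 2 n) ^ C + 1 ≤ (Nat.log 2 n₁) ^ (C + 1) := by
  have hlog : 2 ≤ Nat.log 2 n := Nat.le_log_of_pow_le (by norm_num) (by omega)
  have hmono : Nat.log 2 n ≤ Nat.log 2 n₁ := Nat.log_mono_right h₁
  have h1 : 1 ≤ (Nat.log 2 n) ^ C := Nat.one_le_pow _ _ (by omega)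
  calc (Nat.log 2 n) ^ C + 1 ≤ (Nat.log 2 n) ^ C * 2 := by omega
    _ ≤ (Nat.log 2 n) ^ C * Nat.log 2 n := Nat.mul_le_mul_left _ hlog
    _ = (Nat.log 2 n) ^ (C + 1) := (pow_succ _ _).symm
    _ ≤ (Nat.log 2 n₁) ^ (C + 1) := Nat.pow_le_pow_left hmono _

end Board

section Restrict

variable {n : ℕ}

/-! ## §4b Board calculus II (Boolean, PROVED): first-bit RESTRICTION with phantom absorption; every perfect board
reaches an ODD DIAGONAL board of length `n' ∈ {n−1, n, n+1}` -/

/-- the strategy restricted to inputs with first bit `b` (cut `h+1 ↦ h`; tree `chargeRecursion`). -/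
def restrictS (b : Bool) (y : Strat (n + 1)) : Strat n := fun h v => y h.succ (Fin.cons b v)

/-- the PHANTOM: the long board's cut-`0` function on the `b`-half, a Boolean function of the short input. -/
def phantom (b : Bool) (y : Strat (n + 1)) : (Fin n → Bool) → Bool := fun v => y 0 (Fin.cons b v)

/-- a strategy firing `f` at the single cut `k` and nowhere else. -/
def singleS (k : Fin (n + 1)) (f : (Fin n → Bool) → Bool) : Strat n := fun g v => if g = k then f v else false

/-- a strategy firing `f` at BOTH END cuts `0` and `n` and nowhere else. -/
def endsS (f : (Fin n → Bool) → Bool) : Strat n := fun g v => if g = 0 ∨ g = Fin.last n then f v else false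

/-- `hasDegF_false'` (PumpDial g25, section Restrict). -/
theorem hasDegF_false' {p : ℕ} [Fact p.Prime] (d : ℕ) : HasDegF p (fun _ : Fin n → Bool => false) d := by
  unfold HasDegF
  have : (fun x : Fin n → Bool => if false = true then (1 : ZMod p) else 0) = 0 := by funext; simp
  rw [this]; exact Submodule.zero_mem _

/-- composing with `Fin.cons b` (fixing the first bit) does not raise the degree. -/
theorem hasDegF_cons_comp {p : ℕ} [Fact p.Prime] {d : ℕ} (b : Bool) {f : (Fin (n + 1) → Bool) → Bool}
    (hf : HasDegF p f d) : HasDegF p (fun v : Fin n → Bool => f (Fin.cons b v)) d := by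
  unfold HasDegF at hf ⊢
  refine AdviceFreeQNC0.comp_mem_lowDeg_of_coord (F := ZMod p)
    (fun v : Fin n → Bool => (Fin.cons b v : Fin (n + 1) → Bool)) (fun i => ?_) hf
  refine Fin.cases ?_ (fun j => ?_) i
  · simp only [Fin.cons_zero]
    cases b
    · have : (fun _ : Fin n → Bool => if false = true then (1 : ZMod p) else 0) = 0 := by funext; simp
      rw [this]; exact Submodule.zero_mem _
    · have : (fun _ : Fin n → Bool => if true = true then (1 : ZMod p) else 0) = 1 := by funext; simp
      rw [this, ← mono_empty]; exact mono_mem_lowDeg (by simp)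
  · have e : (fun v : Fin n → Bool => if (Fin.cons b v : Fin (n + 1) → Bool) j.succ = true then (1 : ZMod p) else 0)
        = mono (ZMod p) {j} := by
      funext v; simp only [Fin.cons_succ, mono_apply, Finset.mem_singleton, forall_eq]
    rw [e]; exact mono_mem_lowDeg (by simp)

/-- `hasDegF_restrictS` (PumpDial g25, section Restrict). -/
theorem hasDegF_restrictS {p : ℕ} [Fact p.Prime] {d : ℕ} (b : Bool) {y : Strat (n + 1)}
    (hy : ∀ g, HasDegF p (y g) d) (h : Fin (n + 1)) : HasDegF p (restrictS b y h) d :=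
  hasDegF_cons_comp b (hy h.succ)

/-- `hasDegF_phantom` (PumpDial g25, section Restrict). -/
theorem hasDegF_phantom {p : ℕ} [Fact p.Prime] {d : ℕ} (b : Bool) {y : Strat (n + 1)}
    (hy : ∀ g, HasDegF p (y g) d) : HasDegF p (phantom b y) d :=
  hasDegF_cons_comp b (hy 0)

/-- `hasDegF_singleS` (PumpDial g25, section Restrict). -/
theorem hasDegF_singleS {p : ℕ} [Fact p.Prime] {d : ℕ} (k : Fin (n + 1)) {f : (Fin n → Bool) → Bool}
    (hf : HasDegF p f d) (g : Fin (n + 1)) : HasDegF p (singleS k f g) d := by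
  by_cases hg : g = k
  · have : singleS k f g = f := by funext v; simp [singleS, hg]
    rw [this]; exact hf
  · have : singleS k f g = fun _ => false := by funext v; simp [singleS, hg]
    rw [this]; exact hasDegF_false' d

/-- `hasDegF_endsS` (PumpDial g25, section Restrict). -/
theorem hasDegF_endsS {p : ℕ} [Fact p.Prime] {d : ℕ} {f : (Fin n → Bool) → Bool} (hf : HasDegF p f d)
    (g : Fin (n + 1)) : HasDegF p (endsS f g) d := by
  by_cases hg : g = 0 ∨ g = Fin.last n
  · have : endsS f g = f := by funext v; simp only [endsS, if_pos hg]
    rw [this]; exact hf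
  · have : endsS f g = fun _ => false := by funext v; simp only [endsS, if_neg hg]
    rw [this]; exact hasDegF_false' d

/-- `walkExp_at_last` (PumpDial g25, section Restrict). -/
theorem walkExp_at_last (v : Fin n → Bool) : walkExp v n = 2 * wt v := by
  unfold walkExp; rw [Summit.QuantumAdvantage.AdviceFreeQNC0.ConstBells.wtPrefix_self]; ring

/-- the RESTRICTED game (tree `chargeRecursion`): for a PERFECT `y`, the restriction wins exactly where the phantom
does not fire live: `WIN_{c+1+2b}(y|_b)(v) = ¬(phantom(v) ∧ c + b + |v| ≢ 0)`. -/
theorem ringWinU_restrictS {c : ℕ} {y : Strat (n + 1)} (hy : Perfect c y) (b : Bool) (v : Fin n → Bool) :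
    ringWinU (c + 1 + 2 * b.toNat) (restrictS b y) v = !(phantom b y v && decide ((c + b.toNat + wt v) % 3 ≠ 0)) := by
  have key : xor (phantom b y v && decide ((c + b.toNat + wt v) % 3 ≠ 0))
      (ringWinU (c + 1 + 2 * b.toNat) (restrictS b y) v) = true := by
    rw [← hy (Fin.cons b v)]; exact (chargeRecursion n c y b v).symm
  revert key
  cases (phantom b y v && decide ((c + b.toNat + wt v) % 3 ≠ 0)) <;>
    cases ringWinU (c + 1 + 2 * b.toNat) (restrictS b y) v <;> simp

/-- the game of a single-cut strategy: it wins iff it fires live. -/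
theorem ringWinU_singleS (c : ℕ) (k : Fin (n + 1)) (f : (Fin n → Bool) → Bool) (v : Fin n → Bool) :
    ringWinU c (singleS k f) v = (f v && decide ((c + k.val + walkExp v k.val) % 3 ≠ 0)) := by
  unfold ringWinU
  have hs : (univ.filter fun g : Fin (n + 1) => singleS k f g v = true ∧ (c + g.val + walkExp v g.val) % 3 ≠ 0) =
      (if (f v = true ∧ (c + k.val + walkExp v k.val) % 3 ≠ 0) then {k} else ∅) := by
    ext g
    simp only [mem_filter, mem_univ, true_and, singleS]
    constructor
    · rintro ⟨h1, h2⟩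
      by_cases hg : g = k
      · subst hg; rw [if_pos rfl] at h1; rw [if_pos ⟨h1, h2⟩]; exact mem_singleton_self _
      · rw [if_neg hg] at h1; exact absurd h1 Bool.false_ne_true
    · intro hg
      split_ifs at hg with h
      · rw [mem_singleton] at hg; subst hg; rw [if_pos rfl]; exact h
      · exact absurd hg (Finset.notMem_empty _)
  rw [hs]
  by_cases h : f v = true ∧ (c + k.val + walkExp v k.val) % 3 ≠ 0
  · rw [if_pos h, card_singleton]; obtain ⟨h1, h2⟩ := h; rw [h1, Bool.true_and]; simp [h2]
  · rw [if_neg h, card_empty]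
    rcases Bool.eq_false_or_eq_true (f v) with hf | hf
    · have h2 : ¬ ((c + k.val + walkExp v k.val) % 3 ≠ 0) := fun h2 => h ⟨hf, h2⟩
      rw [hf, Bool.true_and]; simp [h2]
    · rw [hf, Bool.false_and]; decide

/-- `endsS_eq` (PumpDial g25, section Restrict). -/
theorem endsS_eq (hn : 1 ≤ n) (f : (Fin n → Bool) → Bool) :
    endsS f = bxorS (singleS 0 f) (singleS (Fin.last n) f) := by
  funext g v
  unfold endsS bxorS singleS
  have h0L : (0 : Fin (n + 1)) ≠ Fin.last n := by
    intro h; have := congrArg Fin.val h; simp at this; omega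
  by_cases hg0 : g = 0
  · subst hg0; rw [if_pos (Or.inl rfl), if_pos rfl, if_neg h0L]; cases f v <;> rfl
  · by_cases hgL : g = Fin.last n
    · subst hgL; rw [if_pos (Or.inr rfl), if_neg hg0, if_pos rfl]; cases f v <;> rfl
    · rw [if_neg (by tauto), if_neg hg0, if_neg hgL]; rfl

/-- `xor_not_and` (PumpDial g25, section Restrict). -/
private theorem xor_not_and (f a : Bool) : xor (!(f && a)) (f && a) = true := by
  cases f <;> cases a <;> rfl

/-- `xor_not_and_three` (PumpDial g25, section Restrict). -/
private theorem xor_not_and_three (f a b0 bL : Bool) (h : a = xor b0 bL) :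
    xor (xor (!(f && a)) (f && b0)) (f && bL) = true := by
  subst h; cases f <;> cases b0 <;> cases bL <;> rfl

/-- `decide_eq_xor` (PumpDial g25, section Restrict). -/
private theorem decide_eq_xor {P Q R : Prop} [Decidable P] [Decidable Q] [Decidable R]
    (h : (P ∧ Q ∧ ¬R) ∨ (P ∧ ¬Q ∧ R) ∨ (¬P ∧ Q ∧ R) ∨ (¬P ∧ ¬Q ∧ ¬R)) :
    decide P = xor (decide Q) (decide R) := by
  rcases h with ⟨hP, hQ, hR⟩ | ⟨hP, hQ, hR⟩ | ⟨hP, hQ, hR⟩ | ⟨hP, hQ, hR⟩ <;> simp [hP, hQ, hR]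

/-- **RESTRICTION LAW, DIAGONAL case** (`c ≡ n+1` on the long board of length `n+1`): fixing the first bit `b` and
XOR-ing the phantom into the LAST cut (whose liveness test coincides with the phantom's on the diagonal) gives a
perfect strategy on `(n, c+1+2b)` of degree `2d`; both halves `b = 0, 1` work (charges `c+1` and `c+3 ≡ c`). -/
theorem perfAt_restrict_diag {p : ℕ} [Fact p.Prime] {c d : ℕ} (hP : PerfAt p (n + 1) c d)
    (hc : c % 3 = (n + 1) % 3) (b : Bool) : PerfAt p n (c + 1 + 2 * b.toNat) (d + d) := by
  obtain ⟨y, hy, hdeg⟩ := hP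
  refine ⟨bxorS (restrictS b y) (singleS (Fin.last n) (phantom b y)), fun v => ?_, fun g =>
    hasDegF_bxorS (hasDegF_restrictS b hdeg g) (hasDegF_singleS _ (hasDegF_phantom b hdeg) g)⟩
  rw [ringWinU_bxorS, ringWinU_restrictS hy, ringWinU_singleS, Fin.val_last, walkExp_at_last]
  have hiff : ((c + b.toNat + wt v) % 3 ≠ 0) ↔ ((c + 1 + 2 * b.toNat + n + 2 * wt v) % 3 ≠ 0) := by
    cases b <;> simp only [Bool.toNat_false, Bool.toNat_true] <;> omega
  rw [decide_eq_decide.2 hiff]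
  exact xor_not_and _ _

/-- **RESTRICTION LAW, OFF-DIAGONAL case** (`c ≡ n + 2b` on the long board of length `n+1 ≥ 2`): fixing the first bit
`b` and XOR-ing the phantom into BOTH END cuts (the three liveness tests `phantom / cut 0 / cut n` forbid the three
distinct residues of `|v|`, so `𝟙[phantom live] ≡ 𝟙[cut 0 live] + 𝟙[cut n live] (mod 2)`) gives a perfect strategy
on `(n, c+1+2b)` of degree `2d`.  The half is forced: `b = 0` if `c ≡ n`, `b = 1` if `c ≡ n+2`. -/
theorem perfAt_restrict_offdiag {p : ℕ} [Fact p.Prime] {c d : ℕ} (hn : 1 ≤ n) (hP : PerfAt p (n + 1) c d)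
    (b : Bool) (hc : c % 3 = (n + 2 * b.toNat) % 3) : PerfAt p n (c + 1 + 2 * b.toNat) (d + d) := by
  obtain ⟨y, hy, hdeg⟩ := hP
  refine ⟨bxorS (restrictS b y) (endsS (phantom b y)), fun v => ?_, fun g =>
    hasDegF_bxorS (hasDegF_restrictS b hdeg g) (hasDegF_endsS (hasDegF_phantom b hdeg) g)⟩
  rw [ringWinU_bxorS, ringWinU_restrictS hy, endsS_eq hn, ringWinU_bxorS, ringWinU_singleS, ringWinU_singleS,
    Fin.val_zero, Fin.val_last, Summit.QuantumAdvantage.AdviceFreeQNC0.RigidityLaws.walkExp_zero, walkExp_at_last, ← Bool.xor_assoc]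
  apply xor_not_and_three
  apply decide_eq_xor
  have hW : wt v % 3 = 0 ∨ wt v % 3 = 1 ∨ wt v % 3 = 2 := by omega
  have hc3 : c % 3 = 0 ∨ c % 3 = 1 ∨ c % 3 = 2 := by omega
  cases b <;> simp only [Bool.toNat_false, Bool.toNat_true, mul_zero, mul_one, add_zero] at hc ⊢ <;>
    rcases hW with hW | hW | hW <;> rcases hc3 with hc3 | hc3 | hc3 <;> omega

/-- off the diagonal one CLIMBS: `(n, c)` with `c ≢ n` ⟹ the diagonal board `(n+1, c' ≡ n+1)` at degree `d+1`
(charge duality supplies the partner charge, then first-bit gluing). -/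
theorem climb_of_offdiag {p : ℕ} [Fact p.Prime] {c d : ℕ} (hP : PerfAt p n c d) (hc : c % 3 ≠ n % 3) :
    ∃ c', c' % 3 = (n + 1) % 3 ∧ PerfAt p (n + 1) c' (d + 1) := by
  have h3 : c % 3 = (n + 1) % 3 ∨ c % 3 = (n + 2) % 3 := by omega
  rcases h3 with h | h
  · exact ⟨c, by omega, perfAt_glue (perfAt_complS (by omega) hP) hP⟩
  · exact ⟨c + 2, by omega, perfAt_glue (perfAt_charge_mod (by omega) hP) (perfAt_complS (by omega) hP)⟩

/-- odd off-diagonal boards (`n + 1` odd, `n ≥ 1`): restrict to the even board below, then climb back: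
`(n+1, c≢n+1) ⟹ (n+1, c'≡n+1)` at degree `2d + 1` — SAME LENGTH. -/
theorem diag_of_offdiag_sameLen {p : ℕ} [Fact p.Prime] {c d : ℕ} (hn : 1 ≤ n) (hP : PerfAt p (n + 1) c d)
    (hc : c % 3 ≠ (n + 1) % 3) : ∃ c', c' % 3 = (n + 1) % 3 ∧ PerfAt p (n + 1) c' (d + d + 1) := by
  have h3 : c % 3 = n % 3 ∨ c % 3 = (n + 2) % 3 := by omega
  rcases h3 with h | h
  · have hQ := perfAt_restrict_offdiag hn hP false (by simpa using h)
    simp only [Bool.toNat_false, mul_zero, add_zero] at hQ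
    exact climb_of_offdiag hQ (by omega)
  · have hQ := perfAt_restrict_offdiag hn hP true (by simpa using h)
    simp only [Bool.toNat_true, mul_one] at hQ
    exact climb_of_offdiag hQ (by omega)

end Restrict

end Summit.QuantumAdvantage.QuantumAdvantage.Theorems.PumpDial
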